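import Summits.CriticalPhenomena.SAWScalingLimit.Theorems.SAWDevelopingMapHexConjectureRestrictionCocycleWindowTransport
import HarnessLib

/-!
# Crux `HexConjecture` (stmt-CriticalPhenomena-0808), line `root-locality-replaces-loewner`:
the two bounds of the re-plumbed bootstrap (upper: one floor family; lower: the WINDOW MAXIMISER)

Landing target:
`Summits/CriticalPhenomena/SAWScalingLimit/Theorems/SAWDevelopingMapHexConjectureRestrictionCocycleWindowBounds.lean`
(`--supports stmt-CriticalPhenomena-0808`; lead continuation prover-line-stmt-CriticalPhenomena-0808-c5-0).

Write `f(δ) = Z'(a,b)/Z(a,b)` for nested admissible families `Λ' δ ⊆ Λ δ` of a floor domain and, for a floor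
family `e δ`, `f = r_e · Q_e`, `r_e = Z'(a,e)/Z(a,e) ∈ [0,1]`, `Q_e = [Z'(a,b)/Z'(a,e)]·[Z(a,e)/Z(a,b)]`.  The
hypothesis `hQ` is target transport along ARBITRARY admissible floor families (`floorFamily_targetTransport`,
`…WindowTransport.lean`): `Q_e → R(t)` whenever `e δ → a + t`; and `R(t) → c` as `t → 0⁺`.
* `windowUpperBound`: `f ≤ Q_e` for the standard approximants of one floor point, so eventually `f < c + 2η`.
* `windowLowerBound` (the NEW half): from the WINDOW-AVERAGED arch locality (WAL) the window maximiser
  (`windowMaximiser`, `…WindowFloorData.lean`) gives eventually a lattice floor point `e*(δ)` in the window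
  `[θ₁ρ₁/(2δ), θ₀ρ₁/(2δ)]` with `r_{e*}(δ) ≥ 1 - η`.  If `f(δ_k) < (1-η)(c-2η)` along a sequence `δ_k → 0`, a
  subsequence of the scaled positions of `e*(δ_k)` converges to some `a + t̄`, `t̄ ∈ [θ₁ρ₁/2, θ₀ρ₁/2]`; gluing
  the maximisers along that subsequence with the standard approximants of `a + t̄` elsewhere gives an
  ADMISSIBLE floor family `e → a + t̄`, so `Q_e → R(t̄) ≥ c - η` along `𝓝[>] 0`, in particular along the
  subsequence, where `f = r_{e*} Q_e ≥ (1-η)(c-2η)` — contradiction.  So eventually `f ≥ (1-η)(c-2η)`.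
This is what replaces the pointwise short-chord locality (uniform in the span: the open content of the
registered `stub_halfPlaneArchTightness`) by its window average in the line's bootstrap.
Sources: LawlerSchrammWerner2004SAW (§3.4, Prop. 2), DuminilCopinSmirnov2012 (Lemma 2).
-/

noncomputable section

open scoped BigOperators Topology NNReal ENNReal Classical
open Filter Set MeasureTheory Metric
open Literature.Probability.LatticeModels (HexVertex hexGraph hexCenter Site)
open Literature.Probability.RandomPlanarGeometry
open Literature.Probability.RandomPlanarGeometry.SAW
open UpperHalfPlane (upperHalfPlaneSet)

namespace Summit.CriticalPhenomena.SAWScalingLimit.Theorems.HexConjecture.RootLocality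

open Summit.CriticalPhenomena.SAWScalingLimit.Theorems.ObservableToSLE.FloorRatio

/-! ### The window parameters -/

/-- **Choice of the window parameter `θ₀`.**  Given the bound `θb` of the window-averaged arch
locality, the coalescence threshold `τ₀` and the flatness radius `ρ₁`, there is `θ₀` with
`0 < θ₀ ≤ θb`, `θ₀ ≤ 1/4` and `θ₀ · (ρ₁/2) ≤ τ₀/2`. [folklore] -/
theorem window_params {θb τ₀ ρ₁ : ℝ} (hθb : 0 < θb) (hτ₀ : 0 < τ₀) (hρ₁ : 0 < ρ₁) :
    ∃ θ₀ : ℝ, 0 < θ₀ ∧ θ₀ ≤ θb ∧ θ₀ ≤ 1 / 4 ∧ θ₀ * (ρ₁ / 2) ≤ τ₀ / 2 := by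
  refine ⟨min θb (min (1 / 4) (τ₀ / (2 * (ρ₁ / 2)))), lt_min hθb (lt_min (by norm_num) (by positivity)),
    min_le_left _ _, (min_le_right _ _).trans (min_le_left _ _), ?_⟩
  have : min θb (min (1 / 4) (τ₀ / (2 * (ρ₁ / 2)))) ≤ τ₀ / (2 * (ρ₁ / 2)) :=
    (min_le_right _ _).trans (min_le_right _ _)
  rw [le_div_iff₀ (by positivity)] at this
  linarith

/-- **Registered sub-goal `stub_windowParams`** (crux item stmt-CriticalPhenomena-0808, line
`root-locality-replaces-loewner`, lead continuation c5): the window parameter (`window_params`). [folklore] -/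
theorem stub_windowParams : ∀ (θb τ₀ ρ₁ : ℝ), 0 < θb → 0 < τ₀ → 0 < ρ₁ →
    ∃ θ₀ : ℝ, 0 < θ₀ ∧ θ₀ ≤ θb ∧ θ₀ ≤ 1 / 4 ∧ θ₀ * (ρ₁ / 2) ≤ τ₀ / 2 :=
  fun _ _ _ hθb hτ₀ hρ₁ => window_params hθb hτ₀ hρ₁

/-! ### The upper bound of the squeeze -/

/-- **Upper bound.**  With `f = r_e Q_e ≤ Q_e` along the standard approximants of a floor point `a + t` with
`|R t − c| < η`, eventually `f < c + 2η`. [cite: LawlerSchrammWerner2004SAW, §3.4 ("SAW satisfies restriction")] -/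
theorem windowUpperBound (D D' : DobrushinDomain) (ρ : ℝ) (Λ Λ' : ℝ → Finset HexVertex) (m : ℝ → ℤ)
    (a b : ℝ → Sym2 HexVertex) (hρ : 0 < ρ)
    (hev : (∀ᶠ δ : ℝ in 𝓝[>] 0,
      Λ' δ ⊆ Λ δ ∧ hexDomainSimplyConnected (Λ δ) ∧ hexDomainSimplyConnected (Λ' δ) ∧
      (hexGraph.induce (↑(Λ δ) : Set HexVertex)).Preconnected ∧
      (hexGraph.induce (↑(Λ' δ) : Set HexVertex)).Preconnected ∧
      a δ ∈ hexDomainBoundary (Λ δ) ∧ b δ ∈ hexDomainBoundary (Λ δ) ∧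
      a δ ∈ hexDomainBoundary (Λ' δ) ∧ b δ ∈ hexDomainBoundary (Λ' δ) ∧
      Nonempty (HexMidEdgeSAW (Λ' δ) (a δ) (b δ)) ∧
      (∀ v ∈ Λ δ, (δ : ℂ) * hexCenter v ∈ D.carrier ∧ m δ ≤ v.1 1) ∧
      (∀ v ∈ Λ' δ, (δ : ℂ) * hexCenter v ∈ D'.carrier) ∧
      (∀ v : HexVertex, (δ : ℂ) * hexCenter v ∈ ball (D.pt 0) ρ ∪ ball (D.pt 1) ρ →
        ((v ∈ Λ δ ↔ m δ ≤ v.1 1) ∧ (v ∈ Λ' δ ↔ m δ ≤ v.1 1)))))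
    (ha : Tendsto (fun δ : ℝ => (δ : ℂ) * hexMidpoint (a δ)) (𝓝[>] 0) (𝓝 (D.pt 0)))
    (hb : Tendsto (fun δ : ℝ => (δ : ℂ) * hexMidpoint (b δ)) (𝓝[>] 0) (𝓝 (D.pt 1)))
    {ρ₁ : ℝ} (hρ₁ : 0 < ρ₁) (hρ₁ρ : ρ₁ ≤ ρ) {R : ℝ → ℝ} {c : ℝ} (hR : Tendsto R (𝓝[>] 0) (𝓝 c))
    (hQ : ∀ (e : ℝ → Sym2 HexVertex) (t : ℝ), 0 < t → t ≤ ρ₁ / 4 →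
      Tendsto (fun δ : ℝ => (δ : ℂ) * hexMidpoint (e δ)) (𝓝[>] 0) (𝓝 (D.pt 0 + t)) →
      (∀ᶠ δ : ℝ in 𝓝[>] 0, e δ ∈ hexDomainBoundary (Λ δ) ∧ e δ ∈ hexDomainBoundary (Λ' δ) ∧
        Nonempty (HexMidEdgeSAW (Λ δ) (a δ) (e δ)) ∧ Nonempty (HexMidEdgeSAW (Λ' δ) (a δ) (e δ)) ∧
        ∃ x yy : Site 2, a δ = s((x - Pi.single 1 1, 1), (x, 0)) ∧
          e δ = s((yy - Pi.single 1 1, 1), (yy, 0)) ∧ yy 1 = x 1 ∧ yy ≠ x) →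
      Tendsto (fun δ : ℝ =>
        ((∑ γ : HexMidEdgeSAW (Λ' δ) (a δ) (b δ), hexCriticalFugacity ^ γ.length) /
          (∑ γ : HexMidEdgeSAW (Λ' δ) (a δ) (e δ), hexCriticalFugacity ^ γ.length)) *
        ((∑ γ : HexMidEdgeSAW (Λ δ) (a δ) (e δ), hexCriticalFugacity ^ γ.length) /
          (∑ γ : HexMidEdgeSAW (Λ δ) (a δ) (b δ), hexCriticalFugacity ^ γ.length)))
        (𝓝[>] 0) (𝓝 (R t))) :
    ∀ η : ℝ, 0 < η → ∀ᶠ δ : ℝ in 𝓝[>] 0,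
      (∑ γ : HexMidEdgeSAW (Λ' δ) (a δ) (b δ), hexCriticalFugacity ^ γ.length) /
        (∑ γ : HexMidEdgeSAW (Λ δ) (a δ) (b δ), hexCriticalFugacity ^ γ.length) < c + 2 * η := by
  intro η hη
  have hx0 : 0 < hexCriticalFugacity := hexCriticalFugacity_pos_lt_one.1
  obtain ⟨τ₀, hτ₀, hτ⟩ := exists_forall_abs_sub_lt hR hη
  set t : ℝ := min (ρ₁ / 8) (τ₀ / 2) with ht
  have ht0 : 0 < t := lt_min (by positivity) (by positivity)
  have ht8 : t ≤ ρ₁ / 8 := min_le_left _ _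
  have htρ : t ≤ ρ₁ / 4 := ht8.trans (by linarith)
  have htτ : t < τ₀ := (min_le_right _ _).trans_lt (by linarith)
  have hRt : |R t - c| < η := hτ t ht0 htτ
  have hdist : dist (D.pt 0 + (t : ℂ)) (D.pt 0) = t := by
    rw [dist_eq_norm, add_sub_cancel_left, Complex.norm_real, Real.norm_eq_abs, abs_of_pos ht0]
  obtain ⟨sE, _, hsE, hevF⟩ := floorData D D' ρ Λ Λ' m a b hρ hev ha hb (s := D.pt 0 + (t : ℂ))
    (pt_add_ne ht0) (by simp) (by rw [hdist]; linarith) (K := 1 / 16) (by norm_num) (by rw [hdist]; linarith)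
  have hQt := hQ sE t ht0 htρ hsE (by
    filter_upwards [hevF] with δ hF
    obtain ⟨x, -, yy, hx1, -, hyy1, -, hyyx, hax, -, hsEx, -, -, -, hsEbd, hsEbd', -, hne, hne', -⟩ := hF
    exact ⟨hsEbd, hsEbd', hne, hne', x, yy, hax, hsEx, hyy1.trans hx1.symm, hyyx⟩)
  have hQ' := Metric.tendsto_nhds.1 hQt η hη
  filter_upwards [hQ', hev, hevF] with δ hQδ hevδ hF
  obtain ⟨hsubΛ, -⟩ := hevδ
  obtain ⟨-, -, -, -, -, -, -, -, -, -, -, -, -, -, -, -, -, hne_as, hne_as', -⟩ := hF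
  have hZe := (sum_pow_length_pos hne_as).ne'
  have hZ'e := (sum_pow_length_pos hne_as').ne'
  rw [Real.dist_eq] at hQδ
  rw [ratio_eq_mul hZe hZ'e]
  have hr1 : (∑ γ : HexMidEdgeSAW (Λ' δ) (a δ) (sE δ), hexCriticalFugacity ^ γ.length) /
      (∑ γ : HexMidEdgeSAW (Λ δ) (a δ) (sE δ), hexCriticalFugacity ^ γ.length) ≤ 1 :=
    (div_le_one (sum_pow_length_pos hne_as)).2 (archMass_mono hsubΛ _ _)
  have hQnn : 0 ≤ ((∑ γ : HexMidEdgeSAW (Λ' δ) (a δ) (b δ), hexCriticalFugacity ^ γ.length) /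
        (∑ γ : HexMidEdgeSAW (Λ' δ) (a δ) (sE δ), hexCriticalFugacity ^ γ.length)) *
      ((∑ γ : HexMidEdgeSAW (Λ δ) (a δ) (sE δ), hexCriticalFugacity ^ γ.length) /
        (∑ γ : HexMidEdgeSAW (Λ δ) (a δ) (b δ), hexCriticalFugacity ^ γ.length)) := by
    refine mul_nonneg (div_nonneg ?_ ?_) (div_nonneg ?_ ?_) <;>
      exact Finset.sum_nonneg fun _ _ => pow_nonneg hx0.le _
  have habs := abs_lt.1 hQδ
  have habs' := abs_lt.1 hRt
  exact lt_of_le_of_lt (mul_le_of_le_one_left hQnn hr1) (by linarith [habs.2, habs'.2])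

/-! ### The lower bound of the squeeze (the window maximiser and the subsequence argument) -/

/-- **Lower bound.**  See the module docstring. [cite: LawlerSchrammWerner2004SAW, §3.4 ("SAW satisfies restriction") and Prop. 2] -/
theorem windowLowerBound (D D' : DobrushinDomain) (ρ : ℝ) (Λ Λ' : ℝ → Finset HexVertex) (m : ℝ → ℤ)
    (a b : ℝ → Sym2 HexVertex) (hρ : 0 < ρ)
    (hev : (∀ᶠ δ : ℝ in 𝓝[>] 0,
      Λ' δ ⊆ Λ δ ∧ hexDomainSimplyConnected (Λ δ) ∧ hexDomainSimplyConnected (Λ' δ) ∧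
      (hexGraph.induce (↑(Λ δ) : Set HexVertex)).Preconnected ∧
      (hexGraph.induce (↑(Λ' δ) : Set HexVertex)).Preconnected ∧
      a δ ∈ hexDomainBoundary (Λ δ) ∧ b δ ∈ hexDomainBoundary (Λ δ) ∧
      a δ ∈ hexDomainBoundary (Λ' δ) ∧ b δ ∈ hexDomainBoundary (Λ' δ) ∧
      Nonempty (HexMidEdgeSAW (Λ' δ) (a δ) (b δ)) ∧
      (∀ v ∈ Λ δ, (δ : ℂ) * hexCenter v ∈ D.carrier ∧ m δ ≤ v.1 1) ∧
      (∀ v ∈ Λ' δ, (δ : ℂ) * hexCenter v ∈ D'.carrier) ∧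
      (∀ v : HexVertex, (δ : ℂ) * hexCenter v ∈ ball (D.pt 0) ρ ∪ ball (D.pt 1) ρ →
        ((v ∈ Λ δ ↔ m δ ≤ v.1 1) ∧ (v ∈ Λ' δ ↔ m δ ≤ v.1 1)))))
    (ha : Tendsto (fun δ : ℝ => (δ : ℂ) * hexMidpoint (a δ)) (𝓝[>] 0) (𝓝 (D.pt 0)))
    (hb : Tendsto (fun δ : ℝ => (δ : ℂ) * hexMidpoint (b δ)) (𝓝[>] 0) (𝓝 (D.pt 1)))
    {ρ₁ : ℝ} (hρ₁ : 0 < ρ₁) (hρ₁ρ : ρ₁ ≤ ρ) {R : ℝ → ℝ} {c : ℝ} (hR : Tendsto R (𝓝[>] 0) (𝓝 c))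
    (hQ : ∀ (e : ℝ → Sym2 HexVertex) (t : ℝ), 0 < t → t ≤ ρ₁ / 4 →
      Tendsto (fun δ : ℝ => (δ : ℂ) * hexMidpoint (e δ)) (𝓝[>] 0) (𝓝 (D.pt 0 + t)) →
      (∀ᶠ δ : ℝ in 𝓝[>] 0, e δ ∈ hexDomainBoundary (Λ δ) ∧ e δ ∈ hexDomainBoundary (Λ' δ) ∧
        Nonempty (HexMidEdgeSAW (Λ δ) (a δ) (e δ)) ∧ Nonempty (HexMidEdgeSAW (Λ' δ) (a δ) (e δ)) ∧
        ∃ x yy : Site 2, a δ = s((x - Pi.single 1 1, 1), (x, 0)) ∧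
          e δ = s((yy - Pi.single 1 1, 1), (yy, 0)) ∧ yy 1 = x 1 ∧ yy ≠ x) →
      Tendsto (fun δ : ℝ =>
        ((∑ γ : HexMidEdgeSAW (Λ' δ) (a δ) (b δ), hexCriticalFugacity ^ γ.length) /
          (∑ γ : HexMidEdgeSAW (Λ' δ) (a δ) (e δ), hexCriticalFugacity ^ γ.length)) *
        ((∑ γ : HexMidEdgeSAW (Λ δ) (a δ) (e δ), hexCriticalFugacity ^ γ.length) /
          (∑ γ : HexMidEdgeSAW (Λ δ) (a δ) (b δ), hexCriticalFugacity ^ γ.length)))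
        (𝓝[>] 0) (𝓝 (R t)))
    (hWAL : ∀ η : ℝ, 0 < η → ∃ θb : ℝ, 0 < θb ∧ ∀ θ₀ : ℝ, 0 < θ₀ → θ₀ ≤ θb →
      ∃ θ₁ : ℝ, 0 < θ₁ ∧ θ₁ < θ₀ ∧ ∃ R₀ : ℝ, 0 < R₀ ∧ ∀ R : ℝ, R₀ ≤ R →
      ∀ (x : Site 2) (L B : Finset HexVertex) (S : Finset ℤ),
        (∀ v ∈ L, x 1 ≤ v.1 1) →
        (∀ v : HexVertex, v ∈ B ↔ (x 1 ≤ v.1 1 ∧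
          dist (hexCenter v) (hexMidpoint s((x - Pi.single 1 1, 1), (x, 0))) ≤ R)) →
        (∀ d : ℤ, d ∈ S ↔ (θ₁ * R ≤ (d : ℝ) ∧ (d : ℝ) ≤ θ₀ * R)) →
        ∑ d ∈ S, (∑ γ : HexMidEdgeSAW L s((x - Pi.single 1 1, 1), (x, 0))
            s((x + Pi.single 0 d - Pi.single 1 1, 1), (x + Pi.single 0 d, 0)),
          if ∃ v ∈ γ.verts, R ≤ dist (hexCenter v) (hexMidpoint s((x - Pi.single 1 1, 1), (x, 0)))
          then hexCriticalFugacity ^ γ.length else 0) ≤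
        η * ∑ d ∈ S, ∑ γ : HexMidEdgeSAW B s((x - Pi.single 1 1, 1), (x, 0))
            s((x + Pi.single 0 d - Pi.single 1 1, 1), (x + Pi.single 0 d, 0)),
          hexCriticalFugacity ^ γ.length) :
    ∀ η : ℝ, 0 < η → η ≤ 1 / 2 → ∀ᶠ δ : ℝ in 𝓝[>] 0,
      (1 - η) * (c - 2 * η) ≤
      (∑ γ : HexMidEdgeSAW (Λ' δ) (a δ) (b δ), hexCriticalFugacity ^ γ.length) /
        (∑ γ : HexMidEdgeSAW (Λ δ) (a δ) (b δ), hexCriticalFugacity ^ γ.length) := by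
  intro η hη hη2
  have hx0 : 0 < hexCriticalFugacity := hexCriticalFugacity_pos_lt_one.1
  obtain ⟨τ₀, hτ₀, hτ⟩ := exists_forall_abs_sub_lt hR hη
  obtain ⟨θb, hθb, hWθ⟩ := hWAL η hη
  -- the window parameters
  have hρ₂pos : 0 < ρ₁ / 2 := by positivity
  have hρ₂ρ' : ρ₁ / 2 ≤ ρ / 2 := by linarith
  obtain ⟨θ₀, hθ₀pos, hθ₀b, hθ₀q, hθ₀τ⟩ := window_params hθb hτ₀ hρ₁
  have hθ₀h : θ₀ ≤ 1 / 2 := hθ₀q.trans (by norm_num)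
  obtain ⟨θ₁, hθ₁, hθ₁₀, R₀, hR₀, hW⟩ := hWθ θ₀ hθ₀pos hθ₀b
  -- the maximiser, as functions of `δ`
  have hM := windowMaximiser D D' ρ Λ Λ' m a b hρ hev ha hη.le hρ₂pos hρ₂ρ' hθ₁ hθ₁₀ hθ₀h hR₀ hW
  obtain ⟨xf, df, hM'⟩ := exists_fun_of_eventually hM
  -- suppose the lower bound fails frequently
  by_contra hcon
  obtain ⟨u, hu, hu'⟩ := exists_seq_of_not_eventually hcon hM'
  clear hcon
  have hu0 : ∀ k, 0 < u k := fun k => (hu' k).2.2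
  -- the scaled offsets `τ_k = u_k · d*(u_k) ∈ [θ₁ρ₁/2, θ₀ρ₁/2]` and a convergent subsequence
  have hτmem : ∀ k, u k * (df (u k) : ℝ) ∈ Icc (θ₁ * (ρ₁ / 2)) (θ₀ * (ρ₁ / 2)) := by
    intro k
    obtain ⟨-, ⟨-, -, hd1, hd2, -⟩, -⟩ := hu' k
    have hk := hu0 k
    constructor
    · have := mul_le_mul_of_nonneg_left hd1 hk.le
      rwa [← mul_assoc, mul_comm (u k) θ₁, mul_assoc, mul_div_cancel₀ _ hk.ne'] at this
    · have := mul_le_mul_of_nonneg_left hd2 hk.le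
      rwa [← mul_assoc, mul_comm (u k) θ₀, mul_assoc, mul_div_cancel₀ _ hk.ne'] at this
  obtain ⟨tbar, htbar, φs, hφs, hτlim⟩ :=
    tendsto_subseq_of_bounded (isBounded_Icc (θ₁ * (ρ₁ / 2)) (θ₀ * (ρ₁ / 2))) hτmem
  rw [closure_Icc] at htbar
  have htbar0 : 0 < tbar := lt_of_lt_of_le (mul_pos hθ₁ hρ₂pos) htbar.1
  have htbar8 : tbar ≤ ρ₁ / 8 := by
    calc tbar ≤ θ₀ * (ρ₁ / 2) := htbar.2
      _ ≤ 1 / 4 * (ρ₁ / 2) := mul_le_mul_of_nonneg_right hθ₀q hρ₂pos.le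
      _ = ρ₁ / 8 := by ring
  have htbarρ : tbar ≤ ρ₁ / 4 := htbar8.trans (by linarith only [hρ₁])
  have htbarτ : tbar < τ₀ := lt_of_le_of_lt (htbar.2.trans hθ₀τ) (by linarith only [hτ₀])
  have hRtbar : |R tbar - c| < η := hτ tbar htbar0 htbarτ
  -- the standard approximants of `a + tbar` (off the sequence)
  have hdist : dist (D.pt 0 + (tbar : ℂ)) (D.pt 0) = tbar := by
    rw [dist_eq_norm, add_sub_cancel_left, Complex.norm_real, Real.norm_eq_abs, abs_of_pos htbar0]
  obtain ⟨sE, _, hsE, hevF⟩ := floorData D D' ρ Λ Λ' m a b hρ hev ha hb (s := D.pt 0 + (tbar : ℂ))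
    (pt_add_ne htbar0) (by simp) (by rw [hdist]; linarith only [htbar8, hρ₁, hρ₁ρ]) (K := 1 / 16)
    (by norm_num) (by rw [hdist]; linarith only [htbar8, hρ₁, hρ₁ρ])
  -- the glued family (window maximisers on the subsequence, standard approximants elsewhere)
  have hv0 : ∀ k, 0 < (u ∘ φs) k := fun k => hu0 _
  have hvlim : Tendsto (u ∘ φs) atTop (𝓝[>] 0) := hu.comp hφs.tendsto_atTop
  set e : ℝ → Sym2 HexVertex := fun δ => if δ ∈ Set.range (u ∘ φs) then
    s((xf δ + Pi.single 0 (df δ) - Pi.single 1 1, 1), (xf δ + Pi.single 0 (df δ), 0)) else sE δ with he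
  -- its limit
  have helim : Tendsto (fun δ : ℝ => (δ : ℂ) * hexMidpoint (e δ)) (𝓝[>] 0) (𝓝 (D.pt 0 + tbar)) := by
    have hglue := tendsto_piecewise_range hv0
      (g := fun δ => (δ : ℂ) * hexMidpoint
        s((xf δ + Pi.single 0 (df δ) - Pi.single 1 1, 1), (xf δ + Pi.single 0 (df δ), 0)))
      (h := fun δ => (δ : ℂ) * hexMidpoint (sE δ)) (z := D.pt 0 + tbar) ?_ hsE
    · refine hglue.congr fun δ => ?_
      simp only [he]
      split_ifs <;> rfl
    -- along the subsequence: position = scaled root + scaled offset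
    have hfun : ∀ k : ℕ, ((u (φs k) : ℝ) : ℂ) * hexMidpoint (a (u (φs k))) +
        (((u (φs k) : ℝ) * ((df (u (φs k)) : ℤ) : ℝ) : ℝ) : ℂ) =
        ((u (φs k) : ℝ) : ℂ) * hexMidpoint
          s((xf (u (φs k)) + Pi.single 0 (df (u (φs k))) - Pi.single 1 1, 1),
            (xf (u (φs k)) + Pi.single 0 (df (u (φs k))), 0)) := by
      intro k
      obtain ⟨-, ⟨-, hax, -⟩, -⟩ := hu' (φs k)
      rw [smul_hexMidpoint_offset, hax]
    have h1 : Tendsto (fun k => ((u (φs k) : ℝ) : ℂ) * hexMidpoint (a (u (φs k)))) atTop (𝓝 (D.pt 0)) :=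
      ha.comp hvlim
    have h2 : Tendsto (fun k => (((u (φs k) : ℝ) * ((df (u (φs k)) : ℤ) : ℝ) : ℝ) : ℂ)) atTop
        (𝓝 (tbar : ℂ)) :=
      (Complex.continuous_ofReal.tendsto _).comp hτlim
    exact (h1.add h2).congr hfun
  -- its admissibility (eventually, both branches)
  have heE : ∀ᶠ δ : ℝ in 𝓝[>] 0, e δ ∈ hexDomainBoundary (Λ δ) ∧ e δ ∈ hexDomainBoundary (Λ' δ) ∧
      Nonempty (HexMidEdgeSAW (Λ δ) (a δ) (e δ)) ∧ Nonempty (HexMidEdgeSAW (Λ' δ) (a δ) (e δ)) ∧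
      ∃ x yy : Site 2, a δ = s((x - Pi.single 1 1, 1), (x, 0)) ∧
        e δ = s((yy - Pi.single 1 1, 1), (yy, 0)) ∧ yy 1 = x 1 ∧ yy ≠ x := by
    filter_upwards [hM', hevF, self_mem_nhdsWithin] with δ hMδ hF hδpos
    by_cases hmem : δ ∈ Set.range (u ∘ φs)
    · have heδ : e δ = s((xf δ + Pi.single 0 (df δ) - Pi.single 1 1, 1), (xf δ + Pi.single 0 (df δ), 0)) := by
        simp only [he, if_pos hmem]
      obtain ⟨-, hax, hd1, -, -, -, hbd, hbd', hne, hne', -⟩ := hMδ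
      have hd0 : 0 < df δ := by
        have hδ0 : (0 : ℝ) < δ := hδpos
        have hRδ : 0 < θ₁ * (ρ₁ / 2 / δ) := mul_pos hθ₁ (div_pos hρ₂pos hδ0)
        exact_mod_cast lt_of_lt_of_le hRδ hd1
      rw [heδ]
      exact ⟨hbd, hbd', hne, hne', xf δ, xf δ + Pi.single 0 (df δ), hax, rfl, offsetCell_apply_one _ _,
        offsetCell_ne _ hd0.ne'⟩
    · have heδ : e δ = sE δ := by simp only [he, if_neg hmem]
      obtain ⟨x, -, yy, hx1, -, hyy1, -, hyyx, hax, -, hsEx, -, -, -, hsEbd, hsEbd', -, hne, hne', -⟩ := hF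
      rw [heδ]
      exact ⟨hsEbd, hsEbd', hne, hne', x, yy, hax, hsEx, hyy1.trans hx1.symm, hyyx⟩
  -- target transport along the glued family, then along the subsequence
  have hQe := hQ e tbar htbar0 htbarρ helim heE
  have hQv := Metric.tendsto_nhds.1 (hQe.comp hvlim) η hη
  obtain ⟨k, hk⟩ := hQv.exists
  -- at `δ = u (φs k)`: contradiction
  obtain ⟨hnot, hMδ, -⟩ := hu' (φs k)
  apply hnot
  have hmem : u (φs k) ∈ Set.range (u ∘ φs) := ⟨k, rfl⟩
  obtain ⟨-, -, -, -, -, -, -, -, hne, hne', hmax⟩ := hMδ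
  set tk : Sym2 HexVertex := s((xf (u (φs k)) + Pi.single 0 (df (u (φs k))) - Pi.single 1 1, 1),
    (xf (u (φs k)) + Pi.single 0 (df (u (φs k))), 0)) with htk
  have heδ : e (u (φs k)) = tk := by simp only [he, if_pos hmem, htk]
  have hZe := sum_pow_length_pos hne
  have hZ'e := sum_pow_length_pos hne'
  have hr : 1 - η ≤ (∑ γ : HexMidEdgeSAW (Λ' (u (φs k))) (a (u (φs k))) tk,
        hexCriticalFugacity ^ γ.length) /
      (∑ γ : HexMidEdgeSAW (Λ (u (φs k))) (a (u (φs k))) tk, hexCriticalFugacity ^ γ.length) := by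
    rw [le_div_iff₀ hZe]; exact hmax
  have hQnn : 0 ≤ ((∑ γ : HexMidEdgeSAW (Λ' (u (φs k))) (a (u (φs k))) (b (u (φs k))),
          hexCriticalFugacity ^ γ.length) /
        (∑ γ : HexMidEdgeSAW (Λ' (u (φs k))) (a (u (φs k))) tk, hexCriticalFugacity ^ γ.length)) *
      ((∑ γ : HexMidEdgeSAW (Λ (u (φs k))) (a (u (φs k))) tk, hexCriticalFugacity ^ γ.length) /
        (∑ γ : HexMidEdgeSAW (Λ (u (φs k))) (a (u (φs k))) (b (u (φs k))),
          hexCriticalFugacity ^ γ.length)) := by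
    refine mul_nonneg (div_nonneg ?_ ?_) (div_nonneg ?_ ?_) <;>
      exact Finset.sum_nonneg fun _ _ => pow_nonneg hx0.le _
  have hk' : dist ((((∑ γ : HexMidEdgeSAW (Λ' (u (φs k))) (a (u (φs k))) (b (u (φs k))),
          hexCriticalFugacity ^ γ.length) /
        (∑ γ : HexMidEdgeSAW (Λ' (u (φs k))) (a (u (φs k))) tk, hexCriticalFugacity ^ γ.length)) *
      ((∑ γ : HexMidEdgeSAW (Λ (u (φs k))) (a (u (φs k))) tk, hexCriticalFugacity ^ γ.length) /
        (∑ γ : HexMidEdgeSAW (Λ (u (φs k))) (a (u (φs k))) (b (u (φs k))),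
          hexCriticalFugacity ^ γ.length)))) (R tbar) < η := by
    rw [← heδ]; exact hk
  rw [Real.dist_eq] at hk'
  have hQk := (abs_lt.1 hk').1
  have hRc := (abs_lt.1 hRtbar).1
  have h1η : 0 ≤ 1 - η := by linarith only [hη2]
  rw [ratio_eq_mul hZe.ne' hZ'e.ne']
  calc (1 - η) * (c - 2 * η) ≤ (1 - η) * (((∑ γ : HexMidEdgeSAW (Λ' (u (φs k))) (a (u (φs k))) (b (u (φs k))),
          hexCriticalFugacity ^ γ.length) /
        (∑ γ : HexMidEdgeSAW (Λ' (u (φs k))) (a (u (φs k))) tk, hexCriticalFugacity ^ γ.length)) *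
      ((∑ γ : HexMidEdgeSAW (Λ (u (φs k))) (a (u (φs k))) tk, hexCriticalFugacity ^ γ.length) /
        (∑ γ : HexMidEdgeSAW (Λ (u (φs k))) (a (u (φs k))) (b (u (φs k))),
          hexCriticalFugacity ^ γ.length))) :=
        mul_le_mul_of_nonneg_left (by linarith only [hQk, hRc]) h1η
    _ ≤ _ := mul_le_mul_of_nonneg_right hr hQnn


end Summit.CriticalPhenomena.SAWScalingLimit.Theorems.HexConjecture.RootLocality

end
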